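import Summits.BirchSwinnertonDyer.BirchSwinnertonDyer.Theorems.TwoAdicConverseBDPAcLineCoinvariantDatum
import Literature.NumberTheory.EllipticCurves.OrdinaryReductionAscentProofs
import Literature.NumberTheory.EllipticCurves.Rank1Residual.Predicates
import HarnessLib

/-!
# AC-LINE COINVARIANT DATUM (part III): the local good-ordinary hypothesis at `v̄` read off the habitat's `GoodOrd W 2`
# (crux `BDPSelmerLowerDivisibilityAtTwo`, stmt-BirchSwinnertonDyer-24728; route `TwoAdicConverse`, S3)

Helper file `--supports stmt-BirchSwinnertonDyer-24728` (cell `bsd-2adic`, seat `bsd-2adic-tower-1` GEN 55; key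
«PRINT-LEVEL RESIDUALS»). THEOREMS ONLY.  Part II (`…AcLineCoinvariantDatum`, p793101) delivered the datum / the door / the
(e15) inequality modulo PRINT{F4a, F4b} and the typed local hypothesis «`E_K = W.baseChange K` has good ORDINARY
reduction at `v̄`» (`(W.baseChange K).HasGoodReductionAt v̄ ∧ 2 ∤ a_{v̄}(E_K)`).  That hypothesis is the habitat's own
`GoodOrd W 2` (`W/ℚ` globally minimal, good at `2`, `2 ∤ a_2`) ascended to the place `v̄ ∣ 2` of `K`: the tree's
`hasGoodReductionAt_baseChange_of_hasGoodReductionAtPrime` and `not_dvd_frobeniusTraceAt_baseChange_of_isOrdinaryAt`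
(`OrdinaryReductionAscentProofs`, Silverman VII.5.1(a), V.2.3.1: `a_w ≡ a_p^{f} (mod p)`; `IsOrdinaryAt W p` and the habitat's
`GoodOrd W p` are the same conjunction).  So here the three ★ theorems of part II are restated with
`[W.IsGloballyMinimal] (hW : GoodOrd W 2)` in place of `(hgood) (hord)`:

* ★ `acLineCoinvariantDatumAtTwo_of_print_of_goodOrd`, ★ `acLineControl_of_print_of_goodOrd`,
  ★ `one_add_le_of_fibrePinned_of_rankOne_of_print_of_goodOrd` — **(e15) `1 + a ≤ k + m` at (β) modulo PRINT{F4a, F4b}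
  ONLY, every other binder being the habitat's** (`W/ℚ` globally minimal with `GoodOrd W 2`, `K` imaginary quadratic, `2` split
  `v ≠ v̄`, `κ₂` anticyclotomic generator pair, `rank E(K) = 1`, `#Ш[2^∞] < ∞`, the pinning datum, `ch(X_Gr₂) = (C₀)`).

HONEST LABELS as in part II: a fact is a hypothesis; the count of record of O2 does not move; BSD is proved for no curve.
-/

-- D-0017: single-problem summit, the namespace repeats the problem name by design.
set_option linter.dupNamespace false
set_option autoImplicit false

noncomputable section

open scoped Classical

open NumberField IsDedekindDomain Field WeierstrassCurve
open Literature.NumberTheory.EllipticCurves Literature.NumberTheory.GaloisRepresentations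
  Literature.NumberTheory.EllipticCurves.GreenbergSelmer Literature.NumberTheory.EllipticCurves.ZpExtension
  Literature.NumberTheory.EllipticCurves.TwoVariableSelmer Literature.NumberTheory.EllipticCurves.Castella2018
open Summit.BirchSwinnertonDyer.Rank1Residual Literature.NumberTheory.EllipticCurves.Rank1Residual

namespace Summit.BirchSwinnertonDyer.BirchSwinnertonDyer.Theorems.TwoAdicBDPAcLineSpec

section Datum

variable {K : Type} [Field K] [NumberField K]

/-- The habitat's `GoodOrd W 2` (good reduction at `2`, `2 ∤ a_2`) gives, at every place `w ∣ 2` of a number field `K`,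
good ORDINARY reduction of `E_K = W.baseChange K` in the tree's rendering: `(W.baseChange K).HasGoodReductionAt w` and
`2 ∤ a_w(E_K)` (`a_w ≡ a_2^{f(w|2)} (mod 2)`; tree `OrdinaryReductionAscentProofs`).
[cite: SilvermanAEC2009, Prop. VII.5.1(a); Thm. V.2.3.1 (proof)] -/
theorem hasGoodReductionAt_and_not_dvd_frobeniusTraceAt_of_goodOrd (W : WeierstrassCurve ℚ) [W.IsElliptic]
    [W.IsGloballyMinimal] {p : ℕ} [Fact p.Prime] (hW : GoodOrd W p) (w : HeightOneSpectrum (𝓞 K))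
    (hw : ((p : ℕ) : 𝓞 K) ∈ w.asIdeal) :
    (W.baseChange K).HasGoodReductionAt w ∧ ¬ ((p : ℤ) ∣ (W.baseChange K).frobeniusTraceAt w) :=
  ⟨hasGoodReductionAt_baseChange_of_hasGoodReductionAtPrime W hW.1 w hw,
    not_dvd_frobeniusTraceAt_baseChange_of_isOrdinaryAt W ⟨hW.1, hW.2⟩ w hw⟩

/-- ★ **THE AC-LINE COINVARIANT DATUM AT TWO ON THE HABITAT, modulo PRINT{F4a, F4b}**: part II's
`acLineCoinvariantDatumAtTwo_of_print` with the local good-ordinary hypothesis at `v̄` read off `GoodOrd W 2`.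
[cite: GreenbergLNM1716, §2 pp. 70–71, 76] [cite: SilvermanAEC2009, Prop. VII.5.1(a)] -/
theorem acLineCoinvariantDatumAtTwo_of_print_of_goodOrd
    (hF4a : ordinaryReduction_inertia_smul_of_mem_kernelReduction)
    (hF4b : ordinaryReduction_exists_unramified_character_mod_kernelReduction)
    (W : WeierstrassCurve ℚ) [W.IsElliptic] [W.IsGloballyMinimal] (hW : GoodOrd W 2) (hK : IsImaginaryQuadratic K)
    (κ₁ κ₂ : ZpExtension K 2) (hκ₂ : κ₂.IsAnticyclotomic) {v vbar : HeightOneSpectrum (𝓞 K)}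
    (hv : ((2 : ℕ) : 𝓞 K) ∈ v.asIdeal) (hvbar : ((2 : ℕ) : 𝓞 K) ∈ vbar.asIdeal) (hne : vbar ≠ v) :
    ∃ φ : absoluteGaloisGroup K, φ ∈ κ₂.kerSubgroup ⊓ decomp vbar ∧
      κ₂.kerSubgroup ⊓ decomp vbar ≤ (Subgroup.closure ({φ} ∪
        ((ZpExtension.pairKer κ₁ κ₂ ⊓ inertia vbar : Subgroup (absoluteGaloisGroup K)) :
          Set (absoluteGaloisGroup K)))).topologicalClosure ∧
      ∃ F : AddSubgroup ((W.baseChange K).geomPrimaryTorsion 2),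
        (∃ τ : absoluteGaloisGroup K, τ ∈ ZpExtension.pairKer κ₁ κ₂ ∧ τ ∈ inertia vbar ∧ ∀ n ∈ F, τ • n = -n) ∧
        ∃ v : ℕ, ∀ m : (W.baseChange K).geomPrimaryTorsion 2, ∃ j : ℤ, φ • (j • m) - j • m - 2 ^ v • m ∈ F :=
  acLineCoinvariantDatumAtTwo_of_print hF4a hF4b W hK κ₁ κ₂ hκ₂ hv hvbar hne
    (hasGoodReductionAt_and_not_dvd_frobeniusTraceAt_of_goodOrd W hW vbar hvbar).1
    (hasGoodReductionAt_and_not_dvd_frobeniusTraceAt_of_goodOrd W hW vbar hvbar).2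

/-- ★ **THE DOOR'S CONTROL INPUT `hctl` ON THE HABITAT, modulo PRINT{F4a, F4b}**: part II's `acLineControl_of_print` with
`GoodOrd W 2`. [cite: SkinnerUrban2014, Prop. 3.2.8 (p. 23)] [cite: GreenbergLNM1716, §2 pp. 70–71, 76] -/
theorem acLineControl_of_print_of_goodOrd
    (hF4a : ordinaryReduction_inertia_smul_of_mem_kernelReduction)
    (hF4b : ordinaryReduction_exists_unramified_character_mod_kernelReduction)
    (W : WeierstrassCurve ℚ) [W.IsElliptic] [W.IsGloballyMinimal] (hW : GoodOrd W 2) (hK : IsImaginaryQuadratic K)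
    (κ₁ κ₂ : ZpExtension K 2) (γ₁ γ₂ : absoluteGaloisGroup K) [Fact (ZpExtension.IsTopGeneratorPair κ₁ κ₂ γ₁ γ₂)]
    (hκ₂ : κ₂.IsAnticyclotomic) {v vbar : HeightOneSpectrum (𝓞 K)} (hv : ((2 : ℕ) : 𝓞 K) ∈ v.asIdeal)
    (hvbar : ((2 : ℕ) : 𝓞 K) ∈ vbar.asIdeal) (hne : vbar ≠ v) :
    ∃ m : ℕ, ∀ s : unrSelmer₂ κ₁ κ₂ ((W.baseChange K).geomPrimaryTorsion 2) vbar,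
      conjSel₂ κ₁ κ₂ ((W.baseChange K).geomPrimaryTorsion 2) vbar γ₁ s = s →
        2 ^ m • s ∈ Set.range ((W.baseChange K).selmerAcToUnrSelmer₂ 2 κ₁ κ₂ vbar) :=
  acLineControl_of_print hF4a hF4b W hK κ₁ κ₂ γ₁ γ₂ hκ₂ hv hvbar hne
    (hasGoodReductionAt_and_not_dvd_frobeniusTraceAt_of_goodOrd W hW vbar hvbar).1
    (hasGoodReductionAt_and_not_dvd_frobeniusTraceAt_of_goodOrd W hW vbar hvbar).2

end Datum

section Inequality

variable (W : WeierstrassCurve ℚ) [W.IsElliptic] [W.IsGloballyMinimal]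
  {K : Type} [Field K] [NumberField K]
  (κ₁ κ₂ : ZpExtension K 2) (vbar : HeightOneSpectrum (𝓞 K)) (γ₁ γ₂ : absoluteGaloisGroup K)
  [Fact (ZpExtension.IsTopGeneratorPair κ₁ κ₂ γ₁ γ₂)] [Fact (κ₂.IsTopGenerator γ₂)]
  (J : ℤ_[2] →+* PadicComplexInt 2) (C₀ : IwasawaAlgebra₂ 2) (G : PowerSeries (PowerSeries (PadicComplexInt 2)))
  (hpin : ∃ 𝔓 : Ideal (PowerSeries (PowerSeries (IsLocalRing.ResidueField (PadicComplexInt 2)))),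
    𝔓.IsPrime ∧ PowerSeries.map (PowerSeries.map (IsLocalRing.residue (PadicComplexInt 2))) G ∉ 𝔓 ∧
    ∀ (a : ℕ) (C₁ : PowerSeries (PowerSeries (PadicComplexInt 2))),
      IwasawaAlgebra₂.toUnr₂ 2 J C₀ = (2 : PowerSeries (PowerSeries (PadicComplexInt 2))) ^ a * C₁ →
      PowerSeries.map (PowerSeries.map (IsLocalRing.residue (PadicComplexInt 2))) C₁ ≠ 0 →
      PowerSeries.map (PowerSeries.map (IsLocalRing.residue (PadicComplexInt 2))) C₁ ∈
        𝔓 ⊔ Ideal.span {PowerSeries.map (PowerSeries.map (IsLocalRing.residue (PadicComplexInt 2))) G})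
  (hG0 : PowerSeries.constantCoeff (PowerSeries.constantCoeff G) ∈ IsLocalRing.maximalIdeal (PadicComplexInt 2))
  (a : ℕ) (C₁ : PowerSeries (PowerSeries (PadicComplexInt 2)))
  (hC : IwasawaAlgebra₂.toUnr₂ 2 J C₀ = (2 : PowerSeries (PowerSeries (PadicComplexInt 2))) ^ a * C₁)
  (hC₁ : PowerSeries.map (PowerSeries.map (IsLocalRing.residue (PadicComplexInt 2))) C₁ ≠ 0)

include hpin hG0 hC hC₁

/-- ★ **(e15) ON THE HABITAT, modulo PRINT{F4a, F4b} ONLY**: part II's `one_add_le_of_fibrePinned_of_rankOne_of_print` with the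
local good-ordinary hypothesis at `v̄` read off the habitat's `GoodOrd W 2`.  Every other binder is the habitat's (globally minimal
`W/ℚ`, `K` imaginary quadratic, `2` split with `v ≠ v̄` above `2`, `κ₂` anticyclotomic generator pair, `rank E(K) = 1`, `#Ш[2^∞] < ∞`,
the pinning datum, `ch_{Λ_K}(X_Gr₂) = (C₀)`): there are `m`, `k`, a unit `u` with `(J C₀)(0,0) ∣ 2^{k+m}·u` and **`1 + a ≤ k + m`**.
[folklore] [cite: GreenbergLNM1716, §2 pp. 70–71, 76] -/
theorem one_add_le_of_fibrePinned_of_rankOne_of_print_of_goodOrd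
    (hF4a : ordinaryReduction_inertia_smul_of_mem_kernelReduction)
    (hF4b : ordinaryReduction_exists_unramified_character_mod_kernelReduction)
    (hW : GoodOrd W 2) (hK : IsImaginaryQuadratic K) (hsplit : X11b.SplitsIn K 2) (hκ₂ : κ₂.IsAnticyclotomic)
    {v : HeightOneSpectrum (𝓞 K)} (hv : ((2 : ℕ) : 𝓞 K) ∈ v.asIdeal) (hvbar : ((2 : ℕ) : 𝓞 K) ∈ vbar.asIdeal)
    (hne : vbar ≠ v) (hrank : (W.baseChange K).mordellWeilRank = 1)
    (hsha : Finite (AddCommGroup.primaryComponent (W.baseChange K).sha 2))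
    (hC₀ : XGr₂.charIdeal (W.baseChange K) 2 κ₁ κ₂ vbar γ₁ γ₂ = Ideal.span {C₀}) :
    ∃ (m k : ℕ) (u : PadicComplexInt 2), AcSelmer.XAc.HasCharValuationAt (W.baseChange K) 2 κ₂ vbar ∅ γ₂ m ∧
      IsUnit u ∧ PowerSeries.constantCoeff (PowerSeries.constantCoeff (IwasawaAlgebra₂.toUnr₂ 2 J C₀)) ∣
        (2 : PadicComplexInt 2) ^ (k + m) * u ∧ 1 + a ≤ k + m :=
  one_add_le_of_fibrePinned_of_rankOne_of_print W κ₁ κ₂ vbar γ₁ γ₂ J C₀ G hpin hG0 a C₁ hC hC₁ hF4a hF4b hK hsplit hκ₂ hv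
    hvbar hne (hasGoodReductionAt_and_not_dvd_frobeniusTraceAt_of_goodOrd W hW vbar hvbar).1
    (hasGoodReductionAt_and_not_dvd_frobeniusTraceAt_of_goodOrd W hW vbar hvbar).2 hrank hsha hC₀

end Inequality

end Summit.BirchSwinnertonDyer.BirchSwinnertonDyer.Theorems.TwoAdicBDPAcLineSpec

end
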